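import Summits.NavierStokesRegularity.NavierStokesRegularity.Theorems.FilamentSkeletonRssSkeletonJ1RSplit
import Summits.NavierStokesRegularity.NavierStokesRegularity.Theorems.FilamentSkeletonRssNormalBlockMatchedL
import Summits.NavierStokesRegularity.NavierStokesRegularity.Theorems.FilamentSkeletonRssClause13RImp

/-!
# Route `FilamentSkeletonRss` · crux `SkeletonJ1R` (stmt-NavierStokesRegularity-23610) · LINE `switchoff_degree_R`
# (crux-strategist r1, 2026-08-29) — EXISTENCE BY TOPOLOGY: inflating switch-on + Leray–Schauder index + a priori confinement

HEADER: see `Lines/switchoff_degree_R.md` (the line card).  Technique class: Leray–Schauder continuation (fixed-point INDEX of a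
compact streamline map on an open set, homotopy = inflating the region where the true rotating-frame Biot–Savart field is switched
on, constant map at time 0) + A PRIORI estimates on EXACT solutions only.  It replaces the Γ-uniform RIGHT INVERSE of the linearised
in-ball tangency operator with free exit data (the stuck step `stub_analyticClosingL` of the child line (C) of record, and of every
Newton-type line in the two strategy censuses) by an INJECTIVITY-type a priori bound: no surjectivity, no Newton step, no loss of
derivatives to recover.

THE SWITCHED PROBLEM.  Datum: a general-position straight skew datum `(p, t, γ, α, s₀)` (`StraightDatum`, landed GP instance
`straightDatumGP_exists`), scaled by `√Γ`: waist points `Pw j = √Γ•(p j + s₀ j • t j)`, datum lines `Pw j + τ • t j`.  Outer model field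
`outerModel` (X-INDEPENDENT, smooth): inside the tube of radius `ρ√Γ/4` about datum line `j` it is the linear hyperbolic field
`(7/4)⟪y − Pw j, t j⟫ t j − λ (y − Pw j)⊥` (unique zero `Pw j`, unstable manifold = the datum line, every streamline in the tube is
asymptotic to a line parallel to `t j`), blended into `½ y` outside the tubes.  Switch weight `switchWeight ℓ s y = χ(‖y‖/ℓ + 1 − 2s)`,
`χ = Real.smoothTransition (1 − ·)`, `ℓ = Rb√(Γ log Γ)`: at `s = 0` identically `0`, at `s = 1` equal to `1` on the crux ball `‖y‖ ≤ ℓ`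
and `0` beyond `2ℓ`.  Switched field `switchedField … s X y = σ • (u_X y + ½ y − α e₃ × y) + (1 − σ) • outerModel y`, `σ = switchWeight ℓ s y`,
`u_X` = the crux's regularised Biot–Savart field with RIGID UNIT CORES (`Aa ≡ 1`).  A SWITCHED-TANGENT SKELETON at time `s` is an
`N`-tuple of unit-speed `C²` curves, each GLOBALLY tangent to `switchedField s X`, through a zero of it at parameter `0`, switched slip
negative before / positive after the waist, escaping to infinity (`SwitchedTangent`).  At `s = 1` this is EXACT tangency to the TRUE field
on the crux ball (clause 9 of `FlatJ1L`) with far arms designed by the dynamics of `outerModel` (straight lines parallel to `t j`).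

STUBS (the only `sorry`s): `stub_confinement` (XL, hardest: a priori — every switched-tangent skeleton in the COARSE class lies in the
FINE class with a regular hyperbolic waist, uniformly in `s ∈ [0,1]` and `Γ ≥ Γ₂(Rb)`), `stub_lerayschauderSwitchOn` (L: the Leray–Schauder
alternative for the inflating switch-on — confinement ⇒ a switched-tangent skeleton at `s = 1`; Mathlib has no LS degree), `stub_flatOutput`
(M: a fine switched-tangent skeleton at `s = 1` satisfies `FlatJ1L ∧ NearStraightJ1G` with `c = 0`, `Aa ≡ 1`, `w` = true slip), and the record's
`stub_clause13R` BY NAME (13-R piece, stmt-23612, unchanged).  Composition (REAL proofs): `tangentSkeletonNearStraightLS_of` ⟹ the child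
`TangentSkeletonNearStraightL` (stmt-23320) by `Iff.rfl` ⟹ the crux `SkeletonJ1R` through the LANDED split glue `skeletonJ1R_of_children`
(p673130) with the LANDED `NormalBlockMatchedL` (p667604).

MODEL rung, NEGATIVE side of the ladder: a skeleton registration about a HYPOTHETICAL filament-type rotating-self-similar blow-up skeleton;
nothing here proves or refutes any statement about Navier–Stokes regularity.
-/

set_option linter.dupNamespace false
set_option linter.unusedVariables false

noncomputable section

namespace Summit.NavierStokesRegularity.NavierStokesRegularity.Cruxes.SkeletonJ1R.SwitchoffDegreeR

open Set Function Filter MeasureTheory Real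
open Literature.Analysis.FluidPDE
open Summit.NavierStokesRegularity.NavierStokesRegularity.Theses.FilamentSkeletonRss
open Summit.NavierStokesRegularity.NavierStokesRegularity.Theorems.FilamentSkeletonRssSkeletonJ1GSplit
  (NearStraightJ1G StraightDatum straightDatumGP_exists)
open Summit.NavierStokesRegularity.NavierStokesRegularity.Theorems.FilamentSkeletonRssSkeletonJ1LSplit
  (FlatJ1L TangentSkeletonNearStraightLS route_tangentSkeletonNearStraightL_iff)
open scoped InnerProductSpace Topology BigOperators

/-! ## §1 The switched problem (concrete definitions) -/

/-- The crux's regularised Biot–Savart field with RIGID UNIT CORES (`Aa ≡ 1`): the `u` of `FlatJ1L`'s hypothesis `hu` at `Aa k σ = 1`. -/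
def bsField {N : ℕ} (Γ : ℝ) (γ : Fin N → ℝ) (Z : Fin N → ℝ → EuclideanSpace ℝ (Fin 3)) (y : EuclideanSpace ℝ (Fin 3)) :
    EuclideanSpace ℝ (Fin 3) :=
  ∑ k, (Γ*γ k/(4*Real.pi)) • ∫ σ:ℝ, ((‖y-Z k σ‖^2+Real.exp (-(1+Real.eulerMascheroniConstant-Real.log 2))*(1:ℝ))^(3/2:ℝ))⁻¹ •
    cross (deriv (Z k) σ) (y-Z k σ)

/-- The TRUE rotating-frame field of the crux (hypothesis `hv` of `FlatJ1L`): `u_X y + ½ y − α e₃ × y`. -/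
def trueField {N : ℕ} (Γ : ℝ) (γ : Fin N → ℝ) (α : ℝ) (X : Fin N → ℝ → EuclideanSpace ℝ (Fin 3)) (y : EuclideanSpace ℝ (Fin 3)) :
    EuclideanSpace ℝ (Fin 3) :=
  bsField Γ γ X y + (1/2:ℝ) • y - α • cross (EuclideanSpace.single 2 1) y

/-- Smooth switch profile: `= 1` on `(-∞, 0]`, `= 0` on `[1, ∞)`, values in `[0,1]` (Mathlib's `Real.smoothTransition`, reflected). -/
def switchProfile (x : ℝ) : ℝ := Real.smoothTransition (1 - x)

/-- Switch weight at homotopy time `s`: `χ(‖y‖²/ℓ² + 1 − 2s)` (smooth in `y`, squared norm) — identically `0` at `s = 0`; at `s = 1` it is `1` on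
`‖y‖ ≤ ℓ` and `0` on `‖y‖ ≥ √2·ℓ`; in between the true field is switched on in the ball `‖y‖² ≤ (2s−1)ℓ²` with a collar out to `‖y‖² = 2sℓ²`. -/
def switchWeight (ℓ s : ℝ) (y : EuclideanSpace ℝ (Fin 3)) : ℝ := switchProfile (‖y‖ ^ 2 / ℓ ^ 2 + 1 - 2 * s)

/-- Scaled datum waist point `√Γ • (p j + s₀ j • t j)`. -/
def waistPt {N : ℕ} (Γ : ℝ) (p t : Fin N → EuclideanSpace ℝ (Fin 3)) (s₀ : Fin N → ℝ) (j : Fin N) : EuclideanSpace ℝ (Fin 3) :=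
  Real.sqrt Γ • (p j + s₀ j • t j)

/-- Component of `z` normal to the unit vector `t j`. -/
def perpTo {N : ℕ} (t : Fin N → EuclideanSpace ℝ (Fin 3)) (j : Fin N) (z : EuclideanSpace ℝ (Fin 3)) : EuclideanSpace ℝ (Fin 3) :=
  z - ⟪z, t j⟫_ℝ • t j

/-- Tube weight about datum line `j` (radius `R`): `1` where `‖(y − Pw j)⊥‖² ≤ R²`, `0` where `≥ 2R²`, smooth. -/
def tubeWeight {N : ℕ} (Γ R : ℝ) (p t : Fin N → EuclideanSpace ℝ (Fin 3)) (s₀ : Fin N → ℝ) (j : Fin N) (y : EuclideanSpace ℝ (Fin 3)) : ℝ :=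
  Real.smoothTransition (2 - ‖perpTo t j (y - waistPt Γ p t s₀ j)‖ ^ 2 / R ^ 2)

/-- The linear hyperbolic model field of arm `j`: axial rate `7/4` along `t j` from the waist, normal contraction rate `λ` onto the datum line. -/
def armModel {N : ℕ} (Γ lam : ℝ) (p t : Fin N → EuclideanSpace ℝ (Fin 3)) (s₀ : Fin N → ℝ) (j : Fin N) (y : EuclideanSpace ℝ (Fin 3)) :
    EuclideanSpace ℝ (Fin 3) :=
  ((7/4:ℝ) * ⟪y - waistPt Γ p t s₀ j, t j⟫_ℝ) • t j - lam • perpTo t j (y - waistPt Γ p t s₀ j)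

/-- The X-INDEPENDENT outer model field: arm models inside the (pairwise disjoint) tubes of radius `R = ρ√Γ/4`, `½ y` outside. -/
def outerModel {N : ℕ} (Γ ρ lam : ℝ) (p t : Fin N → EuclideanSpace ℝ (Fin 3)) (s₀ : Fin N → ℝ) (y : EuclideanSpace ℝ (Fin 3)) :
    EuclideanSpace ℝ (Fin 3) :=
  (∑ j, tubeWeight Γ (ρ * Real.sqrt Γ / 4) p t s₀ j y • armModel Γ lam p t s₀ j y) +
    (1 - ∑ j, tubeWeight Γ (ρ * Real.sqrt Γ / 4) p t s₀ j y) • (1/2:ℝ) • y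

/-- THE SWITCHED FIELD at homotopy time `s` generated by the skeleton `X` ITSELF (self-consistent at every `s`):
`σ • trueField X y + (1 − σ) • outerModel y`, `σ = switchWeight (Rb√(Γ log Γ)) s y`. -/
def switchedField {N : ℕ} (Γ ρ lam Rb : ℝ) (p t : Fin N → EuclideanSpace ℝ (Fin 3)) (γ : Fin N → ℝ) (α : ℝ) (s₀ : Fin N → ℝ)
    (s : ℝ) (X : Fin N → ℝ → EuclideanSpace ℝ (Fin 3)) (y : EuclideanSpace ℝ (Fin 3)) : EuclideanSpace ℝ (Fin 3) :=
  switchWeight (Rb * Real.sqrt (Γ * Real.log Γ)) s y • trueField Γ γ α X y +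
    (1 - switchWeight (Rb * Real.sqrt (Γ * Real.log Γ)) s y) • outerModel Γ ρ lam p t s₀ y

/-- SWITCHED-TANGENT SKELETON at time `s`: unit-speed `C²` curves, each GLOBALLY tangent to the switched field it generates, through a zero of
that field at parameter `0` (the waist), switched slip `≤ 0` before and `≥ 0` after the waist (closed conditions; with `RegularWaist` the
curve is the oriented unstable streamline of its waist zero), escaping to infinity. -/
def SwitchedTangent {N : ℕ} (Γ ρ lam Rb : ℝ) (p t : Fin N → EuclideanSpace ℝ (Fin 3)) (γ : Fin N → ℝ) (α : ℝ) (s₀ : Fin N → ℝ)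
    (s : ℝ) (X : Fin N → ℝ → EuclideanSpace ℝ (Fin 3)) : Prop :=
  ∀ j, ContDiff ℝ 2 (X j) ∧ (∀ τ, ‖deriv (X j) τ‖ = 1) ∧
    (∀ τ, switchedField Γ ρ lam Rb p t γ α s₀ s X (X j τ) =
      ⟪switchedField Γ ρ lam Rb p t γ α s₀ s X (X j τ), deriv (X j) τ⟫_ℝ • deriv (X j) τ) ∧
    switchedField Γ ρ lam Rb p t γ α s₀ s X (X j 0) = 0 ∧
    (∀ τ, 0 ≤ τ → 0 ≤ ⟪switchedField Γ ρ lam Rb p t γ α s₀ s X (X j τ), deriv (X j) τ⟫_ℝ) ∧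
    (∀ τ, τ ≤ 0 → ⟪switchedField Γ ρ lam Rb p t γ α s₀ s X (X j τ), deriv (X j) τ⟫_ℝ ≤ 0) ∧
    Tendsto (fun τ => ‖X j τ‖) (cocompact ℝ) atTop

/-- COARSE near-straight class about the scaled datum (tilt `≤ Rb/2`, inside the half-tubes, waist within `ρ√Γ/8` of the datum waist). -/
def CoarseClass {N : ℕ} (Γ ρ Rb : ℝ) (p t : Fin N → EuclideanSpace ℝ (Fin 3)) (s₀ : Fin N → ℝ)
    (X : Fin N → ℝ → EuclideanSpace ℝ (Fin 3)) : Prop :=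
  ∀ j, (∀ τ, ‖deriv (X j) τ - t j‖ ≤ Rb / 2) ∧ (∀ τ, ‖perpTo t j (X j τ - waistPt Γ p t s₀ j)‖ ≤ ρ * Real.sqrt Γ / 8) ∧
    ‖X j 0 - waistPt Γ p t s₀ j‖ ≤ ρ * Real.sqrt Γ / 8

/-- FINE class (the a priori bounds): tilt `≤ Rb/4`, offsets and waist displacement `≤ Rb√Γ`, curvature `≤ Rb/√Γ`, and the TRUE slip
`w = ⟪trueField X (X j τ), X j′ τ⟫` has slope in `[3/2 + δ/2, Λ + 1]` at the waist and `|w′| ≤ Λ + 1` everywhere. -/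
def FineClass {N : ℕ} (Γ δ Λ Rb : ℝ) (p t : Fin N → EuclideanSpace ℝ (Fin 3)) (γ : Fin N → ℝ) (α : ℝ) (s₀ : Fin N → ℝ)
    (X : Fin N → ℝ → EuclideanSpace ℝ (Fin 3)) : Prop :=
  ∀ j, (∀ τ, ‖deriv (X j) τ - t j‖ ≤ Rb / 4) ∧ (∀ τ, ‖perpTo t j (X j τ - waistPt Γ p t s₀ j)‖ ≤ Rb * Real.sqrt Γ) ∧
    ‖X j 0 - waistPt Γ p t s₀ j‖ ≤ Rb * Real.sqrt Γ ∧ (∀ τ, ‖iteratedDeriv 2 (X j) τ‖ * Real.sqrt Γ ≤ Rb) ∧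
    Differentiable ℝ (fun τ => ⟪trueField Γ γ α X (X j τ), deriv (X j) τ⟫_ℝ) ∧
    3/2 + δ/2 ≤ deriv (fun τ => ⟪trueField Γ γ α X (X j τ), deriv (X j) τ⟫_ℝ) 0 ∧
    (∀ τ, |deriv (fun τ => ⟪trueField Γ γ α X (X j τ), deriv (X j) τ⟫_ℝ) τ| ≤ Λ + 1)

/-- REGULAR WAIST at time `s`: in the waist box of radius `ρ√Γ/4` the switched field vanishes ONLY at `X j 0`, the switched slip along `X j`
vanishes ONLY at `τ = 0`, and the derivative of the switched field at the waist has `X j′ 0` as an eigenvector with positive eigenvalue and a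
normal block of negative trace and positive determinant (saddle-focus, the clause-12 shape of the landed `NormalBlockMatchedL`). -/
def RegularWaist {N : ℕ} (Γ ρ lam Rb : ℝ) (p t : Fin N → EuclideanSpace ℝ (Fin 3)) (γ : Fin N → ℝ) (α : ℝ) (s₀ : Fin N → ℝ)
    (s : ℝ) (X : Fin N → ℝ → EuclideanSpace ℝ (Fin 3)) : Prop :=
  ∀ j, (∀ y, ‖y - waistPt Γ p t s₀ j‖ ≤ ρ * Real.sqrt Γ / 4 → switchedField Γ ρ lam Rb p t γ α s₀ s X y = 0 → y = X j 0) ∧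
    (∀ τ, ⟪switchedField Γ ρ lam Rb p t γ α s₀ s X (X j τ), deriv (X j) τ⟫_ℝ = 0 → τ = 0) ∧
    ∃ (A : EuclideanSpace ℝ (Fin 3) →L[ℝ] EuclideanSpace ℝ (Fin 3)) (m n : EuclideanSpace ℝ (Fin 3)),
      A = fderiv ℝ (switchedField Γ ρ lam Rb p t γ α s₀ s X) (X j 0) ∧ Orthonormal ℝ ![deriv (X j) 0, m, n] ∧
      A (deriv (X j) 0) = ⟪A (deriv (X j) 0), deriv (X j) 0⟫_ℝ • deriv (X j) 0 ∧ 0 < ⟪A (deriv (X j) 0), deriv (X j) 0⟫_ℝ ∧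
      ⟪A m, m⟫_ℝ + ⟪A n, n⟫_ℝ < 0 ∧ ⟪A n, m⟫_ℝ * ⟪A m, n⟫_ℝ < ⟪A m, m⟫_ℝ * ⟪A n, n⟫_ℝ


/-! ## §2 The stub STATEMENTS (named `Prop`s; the stubs in §3 assert them) -/

/-- STUB C statement · A PRIORI CONFINEMENT (XL — THE HARD STUB).  For every general-position straight datum there are a contraction
rate `λ` and a tolerance ceiling `Rb₁` such that for every `Rb ≤ Rb₁` and all `Γ ≥ Γ₂(Rb)`, UNIFORMLY IN THE HOMOTOPY TIME `s ∈ [0,1]`: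
every switched-tangent skeleton in the COARSE class lies in the FINE class and has REGULAR waists.  Content (line card §Stubs): (i) smooth-
scale confinement by bending dominance in the velocity-DEFECT formulation (affine block ~ strain `O(1)`, bending-band gain `8πRb²/γ`);
(ii) RIPPLE EXCLUSION for the shell band `kμ ≈ κ*`: each circular polarisation is transported ONE WAY at group speed `≍ Γ/μ ≫ |w|`,
its incoming data vanish because beyond the switch both arms are exact `outerModel` streamlines, band sources are exponentially small in
`μ/ℓ` and `μ/(ρ√Γ)` (coefficients vary on scales `ℓ`, `ρ√Γ` only), and the only feedback loop (exit collar ↦ inward bending-band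
disturbance ↦ waist ↦ re-emission) has exponentially small gain — an INJECTIVITY estimate, no inverse taken; (iii) collar slaving:
with the self-induction weight `σ → 0` the tilt precesses neutrally (the offset from the datum line is conserved to leading order and FREE,
since every line parallel to `t j` is an `outerModel` streamline) and is slaved to `O(σ)` at the outer edge; (iv) waist regularity: swirl
pinning + the saddle-focus normal block (the mechanism of the landed `NormalBlockMatchedL`), for the mixed field at every `s`. -/
def Confinement : Prop :=
  ∀ (N : ℕ) (δd ρd Λd Rwd θd mw : ℝ) (p t : Fin N → EuclideanSpace ℝ (Fin 3)) (γ : Fin N → ℝ) (α : ℝ) (s₀ : Fin N → ℝ),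
    0 < N → 0 < δd → 0 < ρd → 0 < Rwd → 0 < θd → 0 < mw → StraightDatum N δd ρd Λd Rwd θd mw p t γ α s₀ →
    (∀ j k, j ≠ k → |⟪t j, t k⟫_ℝ| ≤ 1 - θd) →
    ∃ (lam Rb₁ : ℝ), 0 < lam ∧ 0 < Rb₁ ∧ ∀ Rb : ℝ, 0 < Rb → Rb ≤ Rb₁ → ∃ Γ₂ : ℝ, ∀ Γ : ℝ, Γ₂ ≤ Γ →
      ∀ s : ℝ, 0 ≤ s → s ≤ 1 → ∀ X : Fin N → ℝ → EuclideanSpace ℝ (Fin 3),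
        CoarseClass Γ ρd Rb p t s₀ X → SwitchedTangent Γ ρd lam Rb p t γ α s₀ s X →
          FineClass Γ δd Λd Rb p t γ α s₀ X ∧ RegularWaist Γ ρd lam Rb p t γ α s₀ s X

/-- STUB B statement · THE LERAY–SCHAUDER ALTERNATIVE FOR THE INFLATING SWITCH-ON (L; classical functional analysis, Mathlib has no
Leray–Schauder degree).  At FIXED `Γ` (large) and fixed `λ, Rb`: if, for every homotopy time `s ∈ [0,1]`, every switched-tangent skeleton
in the coarse class is fine with regular waists, then a fine switched-tangent skeleton with regular waists EXISTS at `s = 1`.  Content: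
ambient space `E` = `C¹_b` perturbations of the scaled datum lines; open sets `U_s ⊂ E` (geometric tolerances strictly between FINE and
COARSE, plus: the switched field has exactly one zero in each waist box and it is hyperbolic of type (1 unstable, 2 stable) — an open
condition); the map `Φ^s(X)` = arclength parametrisation from the waist zero of its global UNSTABLE STREAMLINE — compact (integral curves of
`C^∞` fields, `Γ`-dependent bounds suffice), continuous in `(s, X)`, CONSTANT `= datum` for `s` near `0` (switch weight `≡ 0`: the field is
`outerModel`, whose unstable streamlines are the datum lines), and `Fix Φ^s ∩ U_s` = the switched-tangent skeletons in `U_s`; the hypothesis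
makes the parametrised fixed-point set compact in `⋃_s {s} × U_s`, so the fixed-point index is constant `= 1` (Granas–Dugundji §12; Leray–
Schauder 1934; Schaefer 1955). -/
def LeraySchauderSwitchOn : Prop :=
  ∀ (N : ℕ) (δd ρd Λd Rwd θd mw : ℝ) (p t : Fin N → EuclideanSpace ℝ (Fin 3)) (γ : Fin N → ℝ) (α : ℝ) (s₀ : Fin N → ℝ),
    0 < N → 0 < δd → 0 < ρd → 0 < Rwd → 0 < θd → 0 < mw → StraightDatum N δd ρd Λd Rwd θd mw p t γ α s₀ →
    (∀ j k, j ≠ k → |⟪t j, t k⟫_ℝ| ≤ 1 - θd) →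
    ∀ lam Rb : ℝ, 0 < lam → 0 < Rb → Rb ≤ ρd / 16 → ∃ Γ₁ : ℝ, ∀ Γ : ℝ, Γ₁ ≤ Γ →
      (∀ s : ℝ, 0 ≤ s → s ≤ 1 → ∀ X : Fin N → ℝ → EuclideanSpace ℝ (Fin 3),
        CoarseClass Γ ρd Rb p t s₀ X → SwitchedTangent Γ ρd lam Rb p t γ α s₀ s X →
          FineClass Γ δd Λd Rb p t γ α s₀ X ∧ RegularWaist Γ ρd lam Rb p t γ α s₀ s X) →
      ∃ X : Fin N → ℝ → EuclideanSpace ℝ (Fin 3),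
        FineClass Γ δd Λd Rb p t γ α s₀ X ∧ SwitchedTangent Γ ρd lam Rb p t γ α s₀ 1 X ∧ RegularWaist Γ ρd lam Rb p t γ α s₀ 1 X

/-- STUB D statement · FLAT OUTPUT (M; bookkeeping + one far-field estimate).  A FINE switched-tangent skeleton at `s = 1` with regular
waists satisfies the flat clause block `FlatJ1L` and the near-straight regime `NearStraightJ1G` with `c := 0`, rigid unit cores `Aa := 1`
(`KA := 1`), `w :=` the TRUE slip `⟪trueField X (X j τ), X j′ τ⟫`, and datum-derived constants: on the crux ball `‖y‖ ≤ Rb√(Γ log Γ)` the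
switch weight is `1`, so global switched tangency IS clause 9; the unique zero of the TRUE slip needs `½⟪X, X′⟫ > |α|·|⟪e₃ × X, X′⟫| + |⟪u_X, X′⟫|`
off the ball (a Biot–Savart size estimate `|u_X(X j τ)| ≤ C√Γ log Γ` along near-straight separated skeletons); separation / chord–arc / box /
tilt / cone clauses are inequalities on the fine class and `StraightDatum`. -/
def FlatOutput : Prop :=
  ∀ (N : ℕ) (δd ρd Λd Rwd θd mw : ℝ) (p t : Fin N → EuclideanSpace ℝ (Fin 3)) (γ : Fin N → ℝ) (α : ℝ) (s₀ : Fin N → ℝ),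
    0 < N → 0 < δd → 0 < ρd → 0 < Rwd → 0 < θd → 0 < mw → StraightDatum N δd ρd Λd Rwd θd mw p t γ α s₀ →
    (∀ j k, j ≠ k → |⟪t j, t k⟫_ℝ| ≤ 1 - θd) →
    ∃ (δ ρ K Λ Rw cg θ₀ KA Rb₁ : ℝ), 0 < δ ∧ 0 < ρ ∧ 0 < Rw ∧ 0 < cg ∧ 0 < θ₀ ∧ 0 < Rb₁ ∧ 2 * K * ρ ≤ 1 ∧
      ∀ lam Rb : ℝ, 0 < lam → 0 < Rb → Rb ≤ Rb₁ → ∃ Γ₃ : ℝ, ∀ Γ : ℝ, Γ₃ ≤ Γ →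
        ∀ X : Fin N → ℝ → EuclideanSpace ℝ (Fin 3),
          FineClass Γ δd Λd Rb p t γ α s₀ X → SwitchedTangent Γ ρd lam Rb p t γ α s₀ 1 X → RegularWaist Γ ρd lam Rb p t γ α s₀ 1 X →
          ∃ (w : Fin N → ℝ → ℝ) (c : Fin N → ℝ) (Aa : Fin N → ℝ → ℝ),
            FlatJ1L N δ ρ K Λ Rw Rb cg θ₀ KA Γ γ α X w c Aa ∧ NearStraightJ1G N Λ Rb X w Aa

/-! ## §3 The stubs (the ONLY `sorry`s of this file) + the record's 13-R stub BY NAME -/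

/-- STUB C · `stub_confinement` · XL · THE HARDEST.  Why it might fail: (a) a HIGH-Q RIPPLE CAVITY — if the collar turning points reflect the
`κ*` band into a branch that re-converts at O(1) rate (not exponentially small) the injectivity estimate degrades to `1/dist(Γ, resonances)`
and no `Γ`-uniform bound holds; (b) at intermediate `s` the waist box carries the MIXED field and a vortex/strain pair of extra zeros could
enter the box unless `λ` is large against the datum's normal velocities; (c) the neutral collar precession could pick up a slow secular growth
from the `α e₃×` term over the `O(log Γ)^{1/2}`-long collar. [Leray–Schauder a priori method; Kelvin-wave symbol `m(kμ)` of the censuses g1/g2;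
Fukumoto–Miyazaki 1991 (LIA + axial flow), Majda–Bertozzi 2002 §7.1–7.2; Widnall–Bliss–Zalay 1971 (zero self-rotation pitch `κ*`)] -/
theorem stub_confinement : Confinement := by
  sorry

/-- STUB B · `stub_lerayschauderSwitchOn` · L · existence by topology.  Why it might fail: the unstable-streamline map may not be a well-defined
compact self-map on a whole open neighbourhood of the fine class (streamlines of far-from-fixed skeletons leaving the tube or stalling in the
blend zone of `outerModel`) — repair by shrinking `U_s` / truncating the map outside a compact region; and compactness of the parametrised
fixed-point set needs limits of switched-tangent skeletons to be switched-tangent (closed conditions only — ensured by the non-strict slip signs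
in `SwitchedTangent`, the strict facts living in `RegularWaist`).  Formalisation-heavy (no LS degree in Mathlib), mathematically classical.
[Leray–Schauder, Ann. ÉNS 51 (1934) 45–78; Schaefer, Math. Ann. 129 (1955) 415–416; Granas–Dugundji, Fixed Point Theory (2003) §§10–12] -/
theorem stub_lerayschauderSwitchOn : LeraySchauderSwitchOn := by
  sorry

/-- STUB D · `stub_flatOutput` · M · bookkeeping into `FlatJ1L ∧ NearStraightJ1G` (`c := 0`, `Aa := 1`, `KA := 1`, `w :=` true slip,
`δ := δd/2`, `ρ := min (ρd/2) (1/2)`, `K := Rb₁`, `Λ := Λd + 1`, `Rw := Rwd + 1`, `θ₀ := θd/2`, `cg := 1/2`) plus the far-slip positivity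
estimate.  Why it might fail: only through a mis-set constant (then re-set it); the one analytic input is the centreline Biot–Savart bound.
[the flat clause list of the route decl `TangentSkeletonNearStraightL`; Majda–Bertozzi 2002 §7.1 for the matched-core centreline field] -/
theorem stub_flatOutput : FlatOutput := by
  sorry

/-- The record's 13-R stub BY NAME AND SIGNATURE (piece 2 of the split of record, stmt-NavierStokesRegularity-23612; unchanged by this line,
shared with `near_straight_newton_R.lean` and gen-1's `adjoint_rate_R.lean`). -/
theorem stub_clause13R :
    Summit.NavierStokesRegularity.NavierStokesRegularity.Theses.FilamentSkeletonRss.Clause13RNearStraightL := by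
  sorry

/-- Piece 3 of the split of record — DISCHARGED BY NAME: `NormalBlockMatchedL` (stmt-23322) is a theorem in the tree (p667604). No `sorry`. -/
theorem normalBlockL_landed :
    Summit.NavierStokesRegularity.NavierStokesRegularity.Theses.FilamentSkeletonRss.NormalBlockMatchedL :=
  Summit.NavierStokesRegularity.NavierStokesRegularity.Theorems.FilamentSkeletonRssNormalBlockMatchedL.stub_normalBlockL

/-! ## §4 Composition (REAL proofs, no stub constant used until `SkeletonJ1R_of`) -/

/-- COMPOSITION over the three stub STATEMENTS: confinement (C) feeds the Leray–Schauder alternative (B) at every `Γ ≥ Γ₂`, the fixed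
point is booked by (D).  Constants threaded: `Rb₁ := min Rb₁ᴰ (min Rb₁ᶜ (ρd/16))`, `Γ₂ := max Γ₂ᶜ (max Γ₁ᴮ Γ₃ᴰ)`. -/
theorem tangentSkeletonNearStraightLS_of (hC : Confinement) (hB : LeraySchauderSwitchOn) (hD : FlatOutput) :
    TangentSkeletonNearStraightLS := by
  intro N δd ρd Λd Rwd θd mw p t γ α s₀ hN hδ hρ hRw hθ hmw hSD hGP
  obtain ⟨δ, ρ, K, Λ, Rw, cg, θ₀, KA, RbD, hδ', hρ', hRw', hcg, hθ₀', hRbD, hKρ, hDfam⟩ :=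
    hD N δd ρd Λd Rwd θd mw p t γ α s₀ hN hδ hρ hRw hθ hmw hSD hGP
  obtain ⟨lam, RbC, hlam, hRbC, hCfam⟩ := hC N δd ρd Λd Rwd θd mw p t γ α s₀ hN hδ hρ hRw hθ hmw hSD hGP
  have hρ16 : 0 < ρd / 16 := by positivity
  refine ⟨δ, ρ, K, Λ, Rw, cg, θ₀, KA, min RbD (min RbC (ρd / 16)), hδ', hρ', hRw', hcg, hθ₀',
    lt_min hRbD (lt_min hRbC hρ16), hKρ, ?_⟩
  intro Rb hRb hRb₁
  have hRbD' : Rb ≤ RbD := le_trans hRb₁ (min_le_left _ _)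
  have hRbC' : Rb ≤ RbC := le_trans hRb₁ (le_trans (min_le_right _ _) (min_le_left _ _))
  have hRbρ : Rb ≤ ρd / 16 := le_trans hRb₁ (le_trans (min_le_right _ _) (min_le_right _ _))
  obtain ⟨Γ₂, hconf⟩ := hCfam Rb hRb hRbC'
  obtain ⟨Γ₁, hls⟩ := hB N δd ρd Λd Rwd θd mw p t γ α s₀ hN hδ hρ hRw hθ hmw hSD hGP lam Rb hlam hRb hRbρ
  obtain ⟨Γ₃, hout⟩ := hDfam lam Rb hlam hRb hRbD'
  refine ⟨max Γ₂ (max Γ₁ Γ₃), fun Γ hΓ => ?_⟩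
  have hΓ₂ : Γ₂ ≤ Γ := le_trans (le_max_left _ _) hΓ
  have hΓ₁ : Γ₁ ≤ Γ := le_trans (le_trans (le_max_left _ _) (le_max_right _ _)) hΓ
  have hΓ₃ : Γ₃ ≤ Γ := le_trans (le_trans (le_max_right _ _) (le_max_right _ _)) hΓ
  obtain ⟨X, hfine, htan, hreg⟩ := hls Γ hΓ₁ (hconf Γ hΓ₂)
  obtain ⟨w, c, Aa, hflat, hns⟩ := hout Γ hΓ₃ X hfine htan hreg
  exact ⟨X, w, c, Aa, hflat, hns⟩

/-- The child of record `TangentSkeletonNearStraightL` (stmt-NavierStokesRegularity-23320, the heart) from the three stub statements —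
by the landed certificate `route_tangentSkeletonNearStraightL_iff` (`Iff.rfl`).  Real proof. -/
theorem tangentSkeletonNearStraightL_of_hyps (hC : Confinement) (hB : LeraySchauderSwitchOn) (hD : FlatOutput) :
    Summit.NavierStokesRegularity.NavierStokesRegularity.Theses.FilamentSkeletonRss.TangentSkeletonNearStraightL :=
  route_tangentSkeletonNearStraightL_iff.mpr (tangentSkeletonNearStraightLS_of hC hB hD)

/-- **THE SKELETON THEOREM — the crux `FilamentSkeletonRss.SkeletonJ1R` (stmt-NavierStokesRegularity-23610) BY NAME**, through the LANDED
split glue `skeletonJ1R_of_children` (p673130): heart from the switch-off degree stubs, 13-R from the shared record stub, normal block landed.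
Closed modulo the four stub `sorry`s only. -/
theorem SkeletonJ1R_of : Summit.NavierStokesRegularity.NavierStokesRegularity.Theses.FilamentSkeletonRss.SkeletonJ1R :=
  Summit.NavierStokesRegularity.NavierStokesRegularity.Theorems.FilamentSkeletonRssSkeletonJ1RSplit.skeletonJ1R_of_children
    (tangentSkeletonNearStraightL_of_hyps stub_confinement stub_lerayschauderSwitchOn stub_flatOutput) stub_clause13R normalBlockL_landed

end Summit.NavierStokesRegularity.NavierStokesRegularity.Cruxes.SkeletonJ1R.SwitchoffDegreeR

end
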